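import Summits.Ventures.LatticeQCDFlow.Scaling.SchwingerDysonField

/-!
# A Schwinger–Dyson variance floor for smooth lattice actions: `Var_β(S) ≥ |M|·m₀²/(B β²)`

HONEST FRAMING: exact (Metropolis-corrected) sampling algorithms for lattice gauge theory;
figures of merit are autocorrelation/cost numbers at stated couplings and volumes; no
continuum-physics claim.

Venture `LatticeQCDFlow` (cell pub-lqcd), theory-2 (FANOUT row 29), item 127 (v5.4), PART 3 of 3 (§4, the floor).
CUSTODY: theory2 item 127 (GEN-40, HOME tier) re-landed by lean-2 GEN-9 per LEAD LINE 245 RT-30 (202);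
statements and proofs = HOME/lean/theory2/SchwingerDysonVarianceFloor.lean a9784aeca1b7b122 (853 l)
verbatim, split below the `lint.size` line into THREE files (`SchwingerDysonIdentities` §0–§2,
`SchwingerDysonField` §3, `SchwingerDysonVarianceFloor` §4); headers trimmed; docstrings added where the
lint asks.

Companion of items 125 (`SpecificHeatFloorLog2Law`: the `log² R` protocol law for every monotone
exact-reweighting schedule, CONDITIONAL on the specific-heat floor
(SH) `∀ u ≥ β₀, K/u² ≤ Var_u(S)`) and 126 (`ExtensiveSpecificHeat`: an extensive floor at every
coupling, but with the rate `e^{−8N(d−1)|β|}`).  The open cell both leave is the weak-coupling RATE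
`u⁻²` of (SH) with an extensive constant.  This file reduces that rate, for a general smooth action
`S` on Lüscher's field manifold `SU(n)^E` and the ensembles `π_β = 𝒵⁻¹ e^{−β S} D[U]`, to ONE
first-moment input — a lower bound on the mean "directional Laplacian" of `S` along a link — by an
integration-by-parts (Schwinger–Dyson) identity and Cauchy–Schwarz; everything else is
bookkeeping (derivative bounds and locality of `S`).

## The mechanism (all of it proved below, no expansion, every `β > 0`)

Fix a finite family of directions `Y : ι → 𝔰𝔲(n)` and a link `e`.  Write `∂_a = ∂_{e,Y a}`
(Lüscher's link derivative `linkDeriv`), `|∇ₑS|² = Σ_a (∂_a S)²` (`sqGrad`), `Δₑ S = Σ_a ∂_a∂_a S`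
(`dirLap`) and `Φₑ = β|∇ₑS|² − ΔₑS` (`sdField`).  Haar invariance (`∫ ∂_a G D[U] = 0`, tree
`integral_linkDeriv_eq_zero`) applied to `G e^{−βS}` gives the Schwinger–Dyson identity
`∫ ∂_aG e^{−βS} = β ∫ G ∂_aS e^{−βS}` (`sd_identity`), and applied once more to `G ∂_aS` the
DIRICHLET IDENTITY `E_β[G Φₑ] = Σ_a E_β[∂_aG ∂_aS]` (`integral_mul_sdField`).  Consequences:
`E_β[Φₑ] = 0`, `E_β[S Φₑ] = E_β|∇ₑS|² = β⁻¹ E_β[ΔₑS]`; for two links `e ≠ e'` such that `S` has no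
mixed `e,e'` second/third derivatives (`S` local, `e,e'` not in a common plaquette)
`E_β[Φₑ Φₑ'] = 0` (`integral_sdField_mul_sdField_eq_zero`); and `E_β[Φₑ²] = Σ_a E_β[∂_aS ∂_aΦₑ]
≤ k²(2c₂² + c₁c₃) =: B` UNIFORMLY IN `β > 0` from sup bounds `c₁, c₂, c₃` on the first, second and
third `e`-derivatives of `S` (`integral_sdField_sq_mul_weight_le`; the would-be `β`-growth of
`E[Φₑ²]` is cancelled by `β E|∇ₑS|² = E ΔₑS ≤ k c₂`).  With `Φ = Σ_{e∈M} Φₑ` over a family `M` of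
pairwise "non-interacting" links, Cauchy–Schwarz `Cov(S,Φ)² ≤ Var(S)·E[Φ²]` reads

  `(Σ_{e∈M} E_β[ΔₑS])² ≤ β² · |M| · B · Var_β(S)`      (`sq_sum_integral_dirLap_le`),

so a mean-Laplacian floor `E_β[ΔₑS] ≥ m₀ ≥ 0` on every `e ∈ M` gives the EXTENSIVE, `β⁻²`-RATE floor
`Var_β(S) ≥ |M| m₀² / (B β²)` (`variance_ge_of_meanLap`; `variance_ge_of_sumMeanLap` needs only
`Σ_{e∈M} E_β[ΔₑS] ≥ |M| m₀`), i.e. exactly the shape (SH) of item 125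
with `K = |M| m₀²/B` (`specificHeatFloor_of_meanLap`, stated in item 125's `SpecificHeatFloor`
form token for token; `specificHeatFloor_of_sumMeanLap` likewise).

## Reading for the Wilson action (words; NOT formalised in this file)

For `S = S_W` (`ambWilsonAction`) and `Y` = the Parseval frame of `𝔰𝔲(N)` (Literature
`SUNBakryEmery.frame`, Casimir `Σ_α Y_α² = −(N − 1/N)·1`, `sum_frame_mul_frame`):
`Δₑ S_W = (N − 1/N)·Σ_{p ∋ e} Re tr U_p`, so the input `E_β[ΔₑS_W] ≥ m₀` IS mean-plaquette
positivity `E_β[Re tr U_p] ≥ p₀ > 0` uniformly in the volume for `β ≥ β₀` — a first-moment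
statement (provable, e.g., from the chord bound `β·E_β[S_W] ≤ F(0) − F(β)` and a small-ball lower
bound on the free energy, uniformly in `L`; recorded as the residual (MP) in THEORY-2.md §0 gen-40);
locality (`hloc₁`, `hloc₂`) holds for links at lattice distance `≥ 2` (tree
`linkDeriv_eq_zero_of_not_mem` / `linkDeriv_ambWilsonAction_mem`), `|M| ≍ #links/const`
(item 126's even family), and `c₁, c₂, c₃` depend on `(d, N)` only.  Net: (SH_W) with the rate `u⁻²`
and `K ∝ #plaq` ⟸ (MP) + bookkeeping.  None of this paragraph is claimed as proved here.

NOT CLAIMED: any statement at fixed lattice spacing about continuum physics; any value of `m₀`;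
the Wilson instantiation; anything about non-compact groups or fermions.
-/

noncomputable section

set_option linter.unusedSectionVars false

namespace Summit.Ventures.LatticeQCDFlow.Theory2.SchwingerDyson

open MeasureTheory ProbabilityTheory
open Literature.MathematicalPhysics.QuantumFieldTheory
open Literature.MathematicalPhysics.QuantumFieldTheory.Luscher2010
open Literature.MathematicalPhysics.QuantumFieldTheory.WilsonFlow (coeConfig continuous_coeConfig)
open Summit.Ventures.LatticeQCDFlow.TrivializingMaps
open scoped Matrix Matrix.Norms.Frobenius ContDiff

variable {d L n : ℕ} [NeZero L]

/-! ## §4. The variance floor -/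

section Floor

variable {ι : Type*} [Fintype ι] {Y : ι → Matrix (Fin n) (Fin n) ℂ} {S : AmbConfig d L n → ℝ}

/-- **Main inequality.** For a smooth action `S`, a finite family of directions `Y ⊆ 𝔰𝔲(n)`, a
family `M` of links with sup bounds `c₁, c₂, c₃` on the first/second/third link derivatives of `S`
at the links of `M` and no mixed derivatives between distinct links of `M`, and every `β > 0`:
`(Σ_{e∈M} E_β[ΔₑS])² ≤ β²·|M|·k²(2c₂² + c₁c₃)·Var_β(S)`. [folklore] -/
theorem sq_sum_integral_dirLap_le (hS : ContDiff ℝ ∞ S) (hY : ∀ a, Y a ∈ suAlgebra n)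
    (M : Finset (Edge d L)) {β c₁ c₂ c₃ : ℝ} (hβ : 0 < β) (hc₂ : 0 ≤ c₂)
    (h₁ : ∀ (U : GaugeConfig d L (Matrix.specialUnitaryGroup (Fin n) ℂ)), ∀ e ∈ M, ∀ a,
      |linkDeriv e (Y a) S (coeConfig U)| ≤ c₁)
    (h₂ : ∀ (U : GaugeConfig d L (Matrix.specialUnitaryGroup (Fin n) ℂ)), ∀ e ∈ M, ∀ a b,
      |linkDeriv e (Y a) (linkDeriv e (Y b) S) (coeConfig U)| ≤ c₂)
    (h₃ : ∀ (U : GaugeConfig d L (Matrix.specialUnitaryGroup (Fin n) ℂ)), ∀ e ∈ M, ∀ a b,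
      |linkDeriv e (Y a) (linkDeriv e (Y b) (linkDeriv e (Y b) S)) (coeConfig U)| ≤ c₃)
    (hloc₁ : ∀ e ∈ M, ∀ e' ∈ M, e ≠ e' → ∀ a b (W : AmbConfig d L n),
      linkDeriv e (Y a) (linkDeriv e' (Y b) S) W = 0)
    (hloc₂ : ∀ e ∈ M, ∀ e' ∈ M, e ≠ e' → ∀ a b (W : AmbConfig d L n),
      linkDeriv e (Y a) (linkDeriv e' (Y b) (linkDeriv e' (Y b) S)) W = 0) :
    (∑ e ∈ M, ∫ U, dirLap Y S e (coeConfig U) ∂(gibbs S β)) ^ 2 ≤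
      β ^ 2 * (M.card * ((Fintype.card ι : ℝ) ^ 2 * (2 * c₂ ^ 2 + c₁ * c₃))) *
        variance (fun U => S (coeConfig U)) (gibbs S β) := by
  classical
  -- Notation.
  set μ := trivialMeasure (Matrix.specialUnitaryGroup (Fin n) ℂ) d L with hμ
  set B : ℝ := (Fintype.card ι : ℝ) ^ 2 * (2 * c₂ ^ 2 + c₁ * c₃) with hB
  set Z : ℝ := ∫ U, weight S β U ∂μ with hZdef
  have hZ : 0 < Z := integral_weight_pos hS β
  -- The global field `Φ = Σ_{e∈M} Φₑ` (as an ambient function) and its smoothness.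
  set Φ : AmbConfig d L n → ℝ := fun W => ∑ e ∈ M, sdField Y S β e W with hΦdef
  have hΦ : ContDiff ℝ ∞ Φ := ContDiff.sum fun e _ => contDiff_sdField hS Y β e
  -- μ-level facts.
  have F1 : ∫ U, Φ (coeConfig U) * weight S β U ∂μ = 0 := by
    have hpt : (fun U : GaugeConfig d L (Matrix.specialUnitaryGroup (Fin n) ℂ) =>
        Φ (coeConfig U) * weight S β U) =
        fun U => ∑ e ∈ M, sdField Y S β e (coeConfig U) * weight S β U := by
      funext U; simp only [hΦdef, Finset.sum_mul]
    rw [hpt, integral_finsetSum _ (fun e _ => integrable_mul_weight hS β (contDiff_sdField hS Y β e))]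
    exact Finset.sum_eq_zero fun e _ => integral_sdField_mul_weight hS hY β e
  have F2 : β * ∫ U, S (coeConfig U) * Φ (coeConfig U) * weight S β U ∂μ =
      ∑ e ∈ M, ∫ U, dirLap Y S e (coeConfig U) * weight S β U ∂μ := by
    have hpt : (fun U : GaugeConfig d L (Matrix.specialUnitaryGroup (Fin n) ℂ) =>
        S (coeConfig U) * Φ (coeConfig U) * weight S β U) =
        fun U => ∑ e ∈ M, S (coeConfig U) * sdField Y S β e (coeConfig U) * weight S β U := by
      funext U; simp only [hΦdef, Finset.mul_sum, Finset.sum_mul]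
    rw [hpt, integral_finsetSum _ (fun e _ =>
      integrable_mul_weight hS β (hS.mul (contDiff_sdField hS Y β e))), Finset.mul_sum]
    refine Finset.sum_congr rfl fun e _ => ?_
    rw [integral_action_mul_sdField hS hY β e, integral_dirLap_mul_weight hS hY β e]
  have F3 : ∫ U, Φ (coeConfig U) ^ 2 * weight S β U ∂μ ≤ M.card * B * Z := by
    have hpt : (fun U : GaugeConfig d L (Matrix.specialUnitaryGroup (Fin n) ℂ) =>
        Φ (coeConfig U) ^ 2 * weight S β U) = fun U => ∑ e ∈ M, ∑ e' ∈ M,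
        sdField Y S β e (coeConfig U) * sdField Y S β e' (coeConfig U) * weight S β U := by
      funext U
      simp only [hΦdef]
      rw [sq, Finset.sum_mul_sum, Finset.sum_mul]
      exact Finset.sum_congr rfl fun e _ => Finset.sum_mul _ _ _
    rw [hpt, integral_finsetSum _ (fun e _ => integrable_finsetSum _ fun e' _ =>
      integrable_mul_weight hS β ((contDiff_sdField hS Y β e).mul (contDiff_sdField hS Y β e')))]
    have hdiag : ∀ e ∈ M, ∫ U, ∑ e' ∈ M, sdField Y S β e (coeConfig U) *
        sdField Y S β e' (coeConfig U) * weight S β U ∂μ =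
        ∫ U, sdField Y S β e (coeConfig U) ^ 2 * weight S β U ∂μ := by
      intro e he
      rw [integral_finsetSum _ (fun e' _ =>
        integrable_mul_weight hS β ((contDiff_sdField hS Y β e).mul (contDiff_sdField hS Y β e'))),
        Finset.sum_eq_single_of_mem e he (fun e' he' hne =>
          integral_sdField_mul_sdField_eq_zero hS hY β (hloc₁ e' he' e he hne)
            (hloc₂ e' he' e he hne))]
      refine integral_congr_ae (Filter.Eventually.of_forall fun U => ?_)
      show _ = _
      ring
    rw [Finset.sum_congr rfl hdiag]
    calc ∑ e ∈ M, ∫ U, sdField Y S β e (coeConfig U) ^ 2 * weight S β U ∂μ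
        ≤ ∑ _e ∈ M, B * Z := Finset.sum_le_sum fun e he =>
          integral_sdField_sq_mul_weight_le hS hY hβ hc₂ e (fun U => h₁ U e he)
            (fun U => h₂ U e he) (fun U => h₃ U e he)
      _ = M.card * B * Z := by rw [Finset.sum_const, nsmul_eq_mul, hB]; ring
  -- π-level.
  haveI := isProbabilityMeasure_gibbs hS β (d := d) (L := L) (n := n)
  have hSc : Continuous fun U : GaugeConfig d L (Matrix.specialUnitaryGroup (Fin n) ℂ) =>
      S (coeConfig U) := continuous_comp_coeConfig hS
  have hΦc : Continuous fun U : GaugeConfig d L (Matrix.specialUnitaryGroup (Fin n) ℂ) =>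
      Φ (coeConfig U) := continuous_comp_coeConfig hΦ
  have htilt : ∀ g : GaugeConfig d L (Matrix.specialUnitaryGroup (Fin n) ℂ) → ℝ,
      ∫ U, g U ∂(gibbs S β) = (∫ U, g U * weight S β U ∂μ) / Z := by
    intro g
    rw [gibbs_eq_tilted hS β, integral_tilted_eq_div]
    rfl
  set A : ℝ := ∫ U, S (coeConfig U) * Φ (coeConfig U) * weight S β U ∂μ with hA
  set m : ℝ := ∫ U, S (coeConfig U) ∂(gibbs S β) with hm
  have hvar : variance (fun U => S (coeConfig U)) (gibbs S β) =
      ∫ U, (S (coeConfig U) - m) ^ 2 ∂(gibbs S β) :=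
    variance_eq_integral (Gauge.measurable_of_continuous hSc).aemeasurable
  have hV : 0 ≤ variance (fun U => S (coeConfig U)) (gibbs S β) := variance_nonneg _ _
  -- Integrability on `π_β` (everything is continuous on a compact space).
  have Iπ1 : Integrable (fun U => S (coeConfig U) * Φ (coeConfig U)) (gibbs S β) :=
    integrable_of_continuous (hSc.mul hΦc)
  have Iπ2 : Integrable (fun U => m * Φ (coeConfig U)) (gibbs S β) :=
    integrable_of_continuous (continuous_const.mul hΦc)
  have If2 : Integrable (fun U => (S (coeConfig U) - m) ^ 2) (gibbs S β) :=
    integrable_of_continuous ((hSc.sub continuous_const).pow 2)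
  have Ig2 : Integrable (fun U => Φ (coeConfig U) ^ 2) (gibbs S β) :=
    integrable_of_continuous (hΦc.pow 2)
  have Ifg : Integrable (fun U => (S (coeConfig U) - m) * Φ (coeConfig U)) (gibbs S β) :=
    integrable_of_continuous ((hSc.sub continuous_const).mul hΦc)
  -- Cauchy–Schwarz on `π_β` and the values of the three integrals.
  have CS := sq_integral_mul_le If2 Ig2 Ifg
  have hπ1 : ∫ U, S (coeConfig U) * Φ (coeConfig U) ∂(gibbs S β) = A / Z := htilt _
  have hπ2 : ∫ U, Φ (coeConfig U) ∂(gibbs S β) = 0 := by rw [htilt, F1, zero_div]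
  have hπ3 : ∫ U, Φ (coeConfig U) ^ 2 ∂(gibbs S β) =
      (∫ U, Φ (coeConfig U) ^ 2 * weight S β U ∂μ) / Z := htilt _
  have hπ4 : ∀ e, ∫ U, dirLap Y S e (coeConfig U) ∂(gibbs S β) =
      (∫ U, dirLap Y S e (coeConfig U) * weight S β U ∂μ) / Z := fun e => htilt _
  have hcov : ∫ U, (S (coeConfig U) - m) * Φ (coeConfig U) ∂(gibbs S β) = A / Z := by
    have hpt : (fun U : GaugeConfig d L (Matrix.specialUnitaryGroup (Fin n) ℂ) =>
        (S (coeConfig U) - m) * Φ (coeConfig U)) =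
        fun U => S (coeConfig U) * Φ (coeConfig U) - m * Φ (coeConfig U) := by
      funext U; ring
    rw [hpt, integral_sub Iπ1 Iπ2, integral_const_mul, hπ2, mul_zero, sub_zero, hπ1]
  have hP : ∫ U, Φ (coeConfig U) ^ 2 ∂(gibbs S β) ≤ M.card * B := by
    rw [hπ3, div_le_iff₀ hZ]
    exact F3
  have hL : ∑ e ∈ M, ∫ U, dirLap Y S e (coeConfig U) ∂(gibbs S β) = β * (A / Z) := by
    rw [Finset.sum_congr rfl fun e _ => hπ4 e, ← Finset.sum_div, ← F2]
    ring
  have h1 : (A / Z) ^ 2 ≤ variance (fun U => S (coeConfig U)) (gibbs S β) *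
      ∫ U, Φ (coeConfig U) ^ 2 ∂(gibbs S β) := by
    rw [hcov, ← hvar] at CS
    exact CS
  -- Assemble.
  rw [hL]
  calc (β * (A / Z)) ^ 2 = β ^ 2 * (A / Z) ^ 2 := by ring
    _ ≤ β ^ 2 * (variance (fun U => S (coeConfig U)) (gibbs S β) *
        ∫ U, Φ (coeConfig U) ^ 2 ∂(gibbs S β)) := mul_le_mul_of_nonneg_left h1 (sq_nonneg β)
    _ ≤ β ^ 2 * (variance (fun U => S (coeConfig U)) (gibbs S β) * (M.card * B)) :=
        mul_le_mul_of_nonneg_left (mul_le_mul_of_nonneg_left hP hV) (sq_nonneg β)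
    _ = β ^ 2 * (M.card * B) * variance (fun U => S (coeConfig U)) (gibbs S β) := by ring

/-- **The variance floor (sum form).** Under the hypotheses of `sq_sum_integral_dirLap_le`, a floor on
the SUMMED mean Laplacian `|M|·m₀ ≤ Σ_{e∈M} E_β[ΔₑS]` with `m₀ ≥ 0` gives
`Var_β(S) ≥ |M|·m₀² / (k²(2c₂² + c₁c₃)) / β²` — extensive in `|M|`, rate `β⁻²`.  (Only the sum over
`e ∈ M` enters, so for the Wilson action the input is a bound on the TOTAL mean plaquette over the
plaquettes through the family, which torus translation invariance reduces to the mean action.)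
[folklore] -/
theorem variance_ge_of_sumMeanLap (hS : ContDiff ℝ ∞ S) (hY : ∀ a, Y a ∈ suAlgebra n)
    (M : Finset (Edge d L)) {β c₁ c₂ c₃ m₀ : ℝ} (hβ : 0 < β) (hc₂ : 0 ≤ c₂) (hm₀ : 0 ≤ m₀)
    (h₁ : ∀ (U : GaugeConfig d L (Matrix.specialUnitaryGroup (Fin n) ℂ)), ∀ e ∈ M, ∀ a,
      |linkDeriv e (Y a) S (coeConfig U)| ≤ c₁)
    (h₂ : ∀ (U : GaugeConfig d L (Matrix.specialUnitaryGroup (Fin n) ℂ)), ∀ e ∈ M, ∀ a b,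
      |linkDeriv e (Y a) (linkDeriv e (Y b) S) (coeConfig U)| ≤ c₂)
    (h₃ : ∀ (U : GaugeConfig d L (Matrix.specialUnitaryGroup (Fin n) ℂ)), ∀ e ∈ M, ∀ a b,
      |linkDeriv e (Y a) (linkDeriv e (Y b) (linkDeriv e (Y b) S)) (coeConfig U)| ≤ c₃)
    (hloc₁ : ∀ e ∈ M, ∀ e' ∈ M, e ≠ e' → ∀ a b (W : AmbConfig d L n),
      linkDeriv e (Y a) (linkDeriv e' (Y b) S) W = 0)
    (hloc₂ : ∀ e ∈ M, ∀ e' ∈ M, e ≠ e' → ∀ a b (W : AmbConfig d L n),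
      linkDeriv e (Y a) (linkDeriv e' (Y b) (linkDeriv e' (Y b) S)) W = 0)
    (hsum : (M.card : ℝ) * m₀ ≤ ∑ e ∈ M, ∫ U, dirLap Y S e (coeConfig U) ∂(gibbs S β)) :
    M.card * m₀ ^ 2 / ((Fintype.card ι : ℝ) ^ 2 * (2 * c₂ ^ 2 + c₁ * c₃)) / β ^ 2 ≤
      variance (fun U => S (coeConfig U)) (gibbs S β) := by
  have main := sq_sum_integral_dirLap_le hS hY M hβ hc₂ h₁ h₂ h₃ hloc₁ hloc₂
  have hV : 0 ≤ variance (fun U => S (coeConfig U)) (gibbs S β) := variance_nonneg _ _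
  set D : ℝ := (Fintype.card ι : ℝ) ^ 2 * (2 * c₂ ^ 2 + c₁ * c₃) with hD
  set V := variance (fun U => S (coeConfig U)) (gibbs S β)
  by_cases hDpos : 0 < D
  · have key : ((M.card : ℝ) * m₀) ^ 2 ≤ β ^ 2 * (M.card * D) * V :=
      (pow_le_pow_left₀ (by positivity) hsum 2).trans main
    rw [div_div, div_le_iff₀ (by positivity)]
    rcases Nat.eq_zero_or_pos M.card with hM | hM
    · simp [hM]; positivity
    · have hMpos : (0 : ℝ) < M.card := by exact_mod_cast hM
      nlinarith [key, hMpos, hV, hDpos, hβ]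
  · have hnum : 0 ≤ (M.card : ℝ) * m₀ ^ 2 := by positivity
    have h1 : (M.card : ℝ) * m₀ ^ 2 / D ≤ 0 := div_nonpos_iff.2 (Or.inl ⟨hnum, not_lt.1 hDpos⟩)
    exact (div_nonpos_of_nonpos_of_nonneg h1 (sq_nonneg β)).trans hV

/-- **The variance floor.** Under the hypotheses of `sq_sum_integral_dirLap_le`, a mean-Laplacian
floor `m₀ ≤ E_β[ΔₑS]` (`0 ≤ m₀`) at every link of `M` gives
`|M|·m₀² / (k²(2c₂² + c₁c₃)) / β² ≤ Var_β(S)`. [folklore] -/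
theorem variance_ge_of_meanLap (hS : ContDiff ℝ ∞ S) (hY : ∀ a, Y a ∈ suAlgebra n)
    (M : Finset (Edge d L)) {β c₁ c₂ c₃ m₀ : ℝ} (hβ : 0 < β) (hc₂ : 0 ≤ c₂) (hm₀ : 0 ≤ m₀)
    (h₁ : ∀ (U : GaugeConfig d L (Matrix.specialUnitaryGroup (Fin n) ℂ)), ∀ e ∈ M, ∀ a,
      |linkDeriv e (Y a) S (coeConfig U)| ≤ c₁)
    (h₂ : ∀ (U : GaugeConfig d L (Matrix.specialUnitaryGroup (Fin n) ℂ)), ∀ e ∈ M, ∀ a b,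
      |linkDeriv e (Y a) (linkDeriv e (Y b) S) (coeConfig U)| ≤ c₂)
    (h₃ : ∀ (U : GaugeConfig d L (Matrix.specialUnitaryGroup (Fin n) ℂ)), ∀ e ∈ M, ∀ a b,
      |linkDeriv e (Y a) (linkDeriv e (Y b) (linkDeriv e (Y b) S)) (coeConfig U)| ≤ c₃)
    (hloc₁ : ∀ e ∈ M, ∀ e' ∈ M, e ≠ e' → ∀ a b (W : AmbConfig d L n),
      linkDeriv e (Y a) (linkDeriv e' (Y b) S) W = 0)
    (hloc₂ : ∀ e ∈ M, ∀ e' ∈ M, e ≠ e' → ∀ a b (W : AmbConfig d L n),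
      linkDeriv e (Y a) (linkDeriv e' (Y b) (linkDeriv e' (Y b) S)) W = 0)
    (hpos : ∀ e ∈ M, m₀ ≤ ∫ U, dirLap Y S e (coeConfig U) ∂(gibbs S β)) :
    M.card * m₀ ^ 2 / ((Fintype.card ι : ℝ) ^ 2 * (2 * c₂ ^ 2 + c₁ * c₃)) / β ^ 2 ≤
      variance (fun U => S (coeConfig U)) (gibbs S β) :=
  variance_ge_of_sumMeanLap hS hY M hβ hc₂ hm₀ h₁ h₂ h₃ hloc₁ hloc₂ <|
    calc (M.card : ℝ) * m₀ = ∑ _e ∈ M, m₀ := by rw [Finset.sum_const, nsmul_eq_mul]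
      _ ≤ _ := Finset.sum_le_sum hpos

/-- **The specific-heat floor (SH) from a mean-Laplacian floor**, in the exact shape of item 125's
`SpecificHeat.SpecificHeatFloor S β₀ K` (`K = |M| m₀² / (k²(2c₂² + c₁c₃))`): if the derivative
bounds and locality hold and `m₀ ≤ E_u[ΔₑS]` at every link of `M` for every `u ≥ β₀ > 0`, then
`∀ u ≥ β₀, K/u² ≤ Var_{π_u}(S)`. [folklore] -/
theorem specificHeatFloor_of_meanLap (hS : ContDiff ℝ ∞ S) (hY : ∀ a, Y a ∈ suAlgebra n)
    (M : Finset (Edge d L)) {β₀ c₁ c₂ c₃ m₀ : ℝ} (hβ₀ : 0 < β₀) (hc₂ : 0 ≤ c₂) (hm₀ : 0 ≤ m₀)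
    (h₁ : ∀ (U : GaugeConfig d L (Matrix.specialUnitaryGroup (Fin n) ℂ)), ∀ e ∈ M, ∀ a,
      |linkDeriv e (Y a) S (coeConfig U)| ≤ c₁)
    (h₂ : ∀ (U : GaugeConfig d L (Matrix.specialUnitaryGroup (Fin n) ℂ)), ∀ e ∈ M, ∀ a b,
      |linkDeriv e (Y a) (linkDeriv e (Y b) S) (coeConfig U)| ≤ c₂)
    (h₃ : ∀ (U : GaugeConfig d L (Matrix.specialUnitaryGroup (Fin n) ℂ)), ∀ e ∈ M, ∀ a b,
      |linkDeriv e (Y a) (linkDeriv e (Y b) (linkDeriv e (Y b) S)) (coeConfig U)| ≤ c₃)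
    (hloc₁ : ∀ e ∈ M, ∀ e' ∈ M, e ≠ e' → ∀ a b (W : AmbConfig d L n),
      linkDeriv e (Y a) (linkDeriv e' (Y b) S) W = 0)
    (hloc₂ : ∀ e ∈ M, ∀ e' ∈ M, e ≠ e' → ∀ a b (W : AmbConfig d L n),
      linkDeriv e (Y a) (linkDeriv e' (Y b) (linkDeriv e' (Y b) S)) W = 0)
    (hpos : ∀ u : ℝ, β₀ ≤ u → ∀ e ∈ M, m₀ ≤ ∫ U, dirLap Y S e (coeConfig U) ∂(gibbs S u)) :
    ∀ u : ℝ, β₀ ≤ u →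
      M.card * m₀ ^ 2 / ((Fintype.card ι : ℝ) ^ 2 * (2 * c₂ ^ 2 + c₁ * c₃)) / u ^ 2 ≤
        variance (fun U => S (coeConfig U))
          (boltzmannMeasure fun U : GaugeConfig d L (Matrix.specialUnitaryGroup (Fin n) ℂ) =>
            u * S (coeConfig U)) :=
  fun u hu => variance_ge_of_meanLap hS hY M (hβ₀.trans_le hu) hc₂ hm₀ h₁ h₂ h₃ hloc₁ hloc₂ (hpos u hu)

/-- **The specific-heat floor (SH) from a summed mean-Laplacian floor** (sum form of
`specificHeatFloor_of_meanLap`; this is the form the Wilson reading uses, with the axis of the link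
family chosen per coupling `u` on paper). [folklore] -/
theorem specificHeatFloor_of_sumMeanLap (hS : ContDiff ℝ ∞ S) (hY : ∀ a, Y a ∈ suAlgebra n)
    (M : Finset (Edge d L)) {β₀ c₁ c₂ c₃ m₀ : ℝ} (hβ₀ : 0 < β₀) (hc₂ : 0 ≤ c₂) (hm₀ : 0 ≤ m₀)
    (h₁ : ∀ (U : GaugeConfig d L (Matrix.specialUnitaryGroup (Fin n) ℂ)), ∀ e ∈ M, ∀ a,
      |linkDeriv e (Y a) S (coeConfig U)| ≤ c₁)
    (h₂ : ∀ (U : GaugeConfig d L (Matrix.specialUnitaryGroup (Fin n) ℂ)), ∀ e ∈ M, ∀ a b,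
      |linkDeriv e (Y a) (linkDeriv e (Y b) S) (coeConfig U)| ≤ c₂)
    (h₃ : ∀ (U : GaugeConfig d L (Matrix.specialUnitaryGroup (Fin n) ℂ)), ∀ e ∈ M, ∀ a b,
      |linkDeriv e (Y a) (linkDeriv e (Y b) (linkDeriv e (Y b) S)) (coeConfig U)| ≤ c₃)
    (hloc₁ : ∀ e ∈ M, ∀ e' ∈ M, e ≠ e' → ∀ a b (W : AmbConfig d L n),
      linkDeriv e (Y a) (linkDeriv e' (Y b) S) W = 0)
    (hloc₂ : ∀ e ∈ M, ∀ e' ∈ M, e ≠ e' → ∀ a b (W : AmbConfig d L n),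
      linkDeriv e (Y a) (linkDeriv e' (Y b) (linkDeriv e' (Y b) S)) W = 0)
    (hsum : ∀ u : ℝ, β₀ ≤ u →
      (M.card : ℝ) * m₀ ≤ ∑ e ∈ M, ∫ U, dirLap Y S e (coeConfig U) ∂(gibbs S u)) :
    ∀ u : ℝ, β₀ ≤ u →
      M.card * m₀ ^ 2 / ((Fintype.card ι : ℝ) ^ 2 * (2 * c₂ ^ 2 + c₁ * c₃)) / u ^ 2 ≤
        variance (fun U => S (coeConfig U))
          (boltzmannMeasure fun U : GaugeConfig d L (Matrix.specialUnitaryGroup (Fin n) ℂ) =>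
            u * S (coeConfig U)) :=
  fun u hu => variance_ge_of_sumMeanLap hS hY M (hβ₀.trans_le hu) hc₂ hm₀ h₁ h₂ h₃ hloc₁ hloc₂ (hsum u hu)

end Floor

end Summit.Ventures.LatticeQCDFlow.Theory2.SchwingerDyson
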